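/-
Copyright (c) 2026 the pub-hodgecm-mathlib formalisation cell (harness21).  Prover seat hodgecm-mathlib-LH4-p06 (g4), req620 Track A «(D-RAM) FOUR-FRAME» squad (unit U2H,
leaf (ρ2b′-X), organ T5c «TORIC LEVEL CENSUS, M∕E-RAMIFIED» of the payer plan — dealer LH4-plan (g12) WORD #16∕#21∕#22; plan owner LH4-p12 (g4) T5-FRAME; F0P3-p01 (g32) RamM
INDEX-LEMMAS; this seat's sheet `T5cToricLevelCensusRamM.statements.v5` 69f5…∕memo `T5c-RAMM-LEVEL-CENSUS.v1`).  2026-09-04.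
-/
import Summits.HodgeConjecture.HodgeConjecture.Theorems.F0P3cDyRamToricCensusDefs    -- ★ p857239 (LH4-p12 (g4)): `IsOrd ∕ dualGen ∕ levelSet ∕ levelSetDep` (the shared census currency)
import Literature.NumberTheory.LocalFields.QuadraticOrderLevelCountsRamified           -- ★ p857385 (this seat): RamM level counts as index differences → ★ p857372, ★ F1 p857298, ★ p857299, ★ p857267
import Literature.NumberTheory.LocalFields.QuadraticOrderUnitIndexRamified             -- ★ p857313 (this seat): `[𝒪_Mˣ : 𝒪_jˣ] = q^j` on the datum (M, ρ, α, d_ρ)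
import Literature.NumberTheory.Automorphic.UnitaryThreeFourFrameDefs                  -- ★ #0a: `IsRamifiedQuadraticDatum`
import Literature.NumberTheory.LocalFields.QuadraticOrderNormDepthIndexTwoRamified      -- ★ p857465 (this seat, ED. 2): the RamM norm-depth index `[U_M : B] = if dΘ ≤ k+1 then q^{⌈k∕2⌉}∕2 else q^{⌈k∕2⌉}` (explicit `I`)
import Literature.NumberTheory.LocalFields.QuadraticOrderNormTwistClasses              -- ★ p857299 (LH4-p08 (g4)): `exists_subgroup_thetaFixed_units ∕ _depth` (the subgroups `Ũ`, `Ṽ_r`)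
import HarnessLib

/-!
# Crux `H413`, line LH4 «(D-RAM) FOUR-FRAME» — unit U2H, leaf (ρ2b′-X): T5c «TORIC LEVEL CENSUS, M∕E RAMIFIED» — the u-free level sets `levelSet j a` of the ★ DEFS leaf
# in the RAMIFIED frame, as INDEX DIFFERENCES `q^j∕[U_M : B] − q^j∕[U_M : B′]` (F0P3-p01 (g32)'s `|G_j|·(F(c;v) − F(c+1;v))`)

Cell `hodgecm-mathlib` (D-0151), FLOOR 0, crux item H413 = `stmt-HodgeConjecture-24833`, route of record `HCCMUnconditional`; squad F0∕P3c∕LH4.  THEOREMS ONLY (no `def`, no instance,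
no notation, no `sorry`, default heartbeats); lane `--supports stmt-HodgeConjecture-24833 --as helper` (count-neutral).  Socket served: the organ package `hOrg` of the (ρ2b′-X)
spine (★ p857061 ∘ ★ p857119 ∘ ★ p857277, LH4-p14 (g3)) reads the toric census through LH4-p12 (g4)'s O-W∕O-Cone and LH4-p04 (g3)'s T5s, which consume `#levelSet_h(j,a)`
in the ★ DEFS currency `Summit…F0P3cDyRamToricCensusDefs.levelSet` — THIS FILE delivers that count for the M∕E-RAMIFIED type (both ρ and Θ ramified on the same uniformiser
`α` of `M`; conductor `ϖE^j`, `|ϖE| = exp(−2)`).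

THE MATHEMATICS (all ★, this file only assembles): `levelSet j a` = order lattices `x₀·𝒪_j` with dual generator `y = h·x₀Θx₀·ϖE^j(α−ρα)` integral, Gram-primitive, `|y| = |ϖE|^a`
(★ T4c).  ★ F1 (p857298): such lattices ↔ cosets of `H = 𝒪_jˣ` of the generators.  ★ p857372∕p857385 (this seat): generators = `α^{k₀}·{ω : |ω| = 1, |1 + (η·t(α^{k₀}))·t(ω)| = X}`
with `v_h + d_ρ + 2k₀ + 2j = 2a`, `X = exp(2a − 2j − d_ρ)` EXACT for `a ≥ 1` (★ p857267 parity dichotomy) ∕ `≤ exp(−(2j + d_ρ))` for `a = 0`, and, given a unit translator `ω₀`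
for the class `η·t(α^{k₀})` (`η = ρh∕h`; g32's two class rows `v ∈ {u_s, u_s·ε}` by the parity of `k₀`), the count is `[B : H] − [B′ : H]` (resp. `[B : H]`, resp. `0`).
★ p857313: `[U_M : H] = q^j` (Mars on (M, ρ, α, d_ρ)); tower multiplicativity `[B : H]·[U_M : B] = q^j`.
* §1 `v_sub_map_eq_exp_of_datum` — the datum letter `|α − ρα| = |α|^{d_ρ}` as `exp(−d_ρ)`.
* §2 THE COUNTS IN DEFS CURRENCY: **`ncard_levelSet_eq_relIndex_sub_of_ramified`** (`a ≥ 1`), **`ncard_levelSet_zero_eq_relIndex_of_ramified`** (`a = 0`),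
  **`ncard_levelSet_eq_zero_of_ramified`** (no solution of the level equation) — ★ p857385 read on `levelSet` (definitional unfolding of `IsOrd`∕`dualGen`).
* §3 THE INDEX FORM: **`ncard_levelSet_mul_eq_of_ramified`** — with `U = {|u| = 1}` and `H ≤ B′ ≤ B ≤ U`: `#levelSet(j,a)·[U:B]·[U:B′] = q^j·([U:B′] − [U:B])`
  (`a ≥ 1`; `[U : H] = q^j` by ★ p857313) and `#levelSet(j,0)·[U:B] = q^j` — g32's `|G_j|·(1∕I(c) − 1∕I(c+1))` with `I := [U : B]` left symbolic (his (L-RM3) row supplies the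
  values `1,1,1,1,2,2,4,4,…` per (d_ρ,d_Θ); the membership rows = the translator hypothesis `hη`).
* §4 (ED. 2, append-only) `hfin` DISCHARGED and the EXPLICIT KERNELS: `finite_image_mk_smul_of_relIndex_ne_zero` (the class image is finite since `[B : H] | q^j`), the
  QUOTIENT FORMS **`ncard_levelSet_eq_div_sub_div_of_ramified`** `#levelSet(j,a) = q^j∕[U:B] − q^j∕[U:B′]` (`a ≥ 1`) ∕ **`ncard_levelSet_zero_eq_div_of_ramified`** (`a = 0`), the level
  bridges `v_map_pow_eq_exp_neg_two_mul` (`|jK π′^n| = exp(−2n)`), `v_le_exp_odd_iff_of_theta_fixed` (odd rounding on `Θ`-fixed values), `theta_norm_sub_map` (`N(ω) − ρN(ω)` is `Θ`-fixed),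
  and — plugging ★ p857465's `I = [U_M : B]` along the third field `K′ = K♮` (datum `(σ′, π′, d′)`, order-compatible `jK`, `Θ`-datum `(Θ, ϖ, dΘ, tΘ)`, base-unit token `hFN`) —
  **`ncard_levelSet_eq_explicit_even_of_ramified`** (K♮-level `k = 2m`: `#levelSet(j,a) = q^j∕I(2m) − q^j∕I(2m+1)`, `I(2m) = if dΘ ≤ 2m+1 then q^m∕2 else q^m`,
  `I(2m+1) = if dΘ ≤ 2m+2 then q^{m+1}∕2 else q^{m+1}`) and **`ncard_levelSet_eq_explicit_odd_of_ramified`** (`k = 2m+1`; with `dΘ` even this is `0`) — g32's rows as theorems.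
* §5 (ED. 3, append-only) THE LEVEL-0 KERNELS EXPLICIT (what MAP seam S8 ∕ brick (C2) reads): **`ncard_levelSet_zero_eq_explicit_even_of_ramified`** (`#levelSet(j,0) = q^j ∕ I(2m)`,
  `2(d′ + 2m) = 2j + d_ρ`) and **`ncard_levelSet_zero_eq_explicit_odd_of_ramified`** (`= q^j ∕ I(2m+1)`, `2(d′ + 2m + 1) = 2j + d_ρ`), `I` as in §4 (★ p857465).
HONEST LABEL.  Count-neutral (`--supports`); unconditional algebra over ★ organs; the census LAW (ρ2b′-X) is NOT asserted — `HC_CM` is proved only modulo the 7 printed citations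
(2 remaining named inputs: hLiu418 = `stmt-HodgeConjecture-24832`, h413 = `stmt-HodgeConjecture-24833`) until rung 0 closes.

## References
* [Flicker1998UnitaryFL] Y. Z. Flicker, *Elementary proof of the fundamental lemma for a unitary group*, Canad. J. Math. 50 (1998): Prop. 7 p. 84; §6 p. 95 REMARK (Mars).
* [Serre1979] J.-P. Serre, *Local Fields*, GTM 67 (1979): Ch. V §1–§3; Ch. III §6 Prop. 12.
* [Jacobowitz1962] R. Jacobowitz, *Hermitian forms over local fields*, Amer. J. Math. 84 (1962): §4.
-/

set_option autoImplicit false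

noncomputable section

namespace Summit.HodgeConjecture.HodgeConjecture.Cruxes.H413.F0P3cDyRamToricLevelCensusRamM

open WithZero
open scoped Pointwise Valued
open Literature.NumberTheory.Automorphic.UnitaryThreeFourFrame (IsRamifiedQuadraticDatum)
open Literature.NumberTheory.LocalFields.QuadraticOrder
open Summit.HodgeConjecture.HodgeConjecture.Cruxes.H413.F0P3cDyRamToricCensusDefs

variable {K : Type} [Field K] [Valued K ℤᵐ⁰] {ρ Θ : K →+* K} {α ϖE h : K} {dρ t : ℕ}

/-! ## §1 Datum letters -/

/-- The ramified datum `(ρ, α, d_ρ)` gives `|α − ρα| = exp(−d_ρ)` (`|α| = exp(−1)`, `|α − ρα| = |α|^{d_ρ}`). [cite: Serre1979, Ch. III §6 Prop. 12] -/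
theorem v_sub_map_eq_exp_of_datum (hD : IsRamifiedQuadraticDatum ρ α dρ t) : Valued.v (α - ρ α) = exp (-(dρ : ℤ)) := by
  obtain ⟨-, -, hα, -, hdρ, -, -⟩ := hD
  rw [hdρ, hα, ← exp_nsmul]; congr 1; simp only [nsmul_eq_mul]; ring

/-- In a ramified datum the uniformiser is moved: `ρα ≠ α` (else `|α − ρα| = 0 ≠ |α|^{d_ρ}`). [cite: Serre1979, Ch. III §6 Prop. 12] -/
theorem map_ne_self_of_datum (hD : IsRamifiedQuadraticDatum ρ α dρ t) : ρ α ≠ α := by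
  intro hρα
  have h := v_sub_map_eq_exp_of_datum hD
  rw [hρα, sub_self, map_zero] at h
  exact exp_ne_zero h.symm

/-! ## §2 The counts of `levelSet j a` in the ramified frame (★ p857385 read on the DEFS leaf) -/

/-- **`#levelSet(j,a) = [B : 𝒪_jˣ] − [B′ : 𝒪_jˣ]`, `a ≥ 1`, M∕E RAMIFIED.**  Frame: `(M, ρ, α, d_ρ)` a ramified quadratic datum, `Θ` isometric, `ϖE` `ρ`-fixed with `|ϖE| = exp(−2)`,
`h ≠ 0` with `|h| = exp(−v_h)`; level equation `v_h + d_ρ + 2k₀ + 2j = 2a`; a unit translator `ω₀` for the class `η·t(α^{k₀})`; `H = 𝒪_jˣ`, `B ⊇ B′` the norm-depth subgroups at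
`exp(2a − 2j − d_ρ)` and one step below, `H ≤ B′`, finiteness of the translated class image. [cite: Flicker1998UnitaryFL, p. 84] [cite: Serre1979, Ch. V §3] [cite: Jacobowitz1962, §4] -/
theorem ncard_levelSet_eq_relIndex_sub_of_ramified (hD : IsRamifiedQuadraticDatum ρ α dρ t) (hvΘ : ∀ x, Valued.v (Θ x) = Valued.v x)
    (hϖE : Valued.v ϖE = exp (-2 : ℤ)) (hρϖ : ρ ϖE = ϖE) (hh : h ≠ 0) {vh : ℤ} (hvh : Valued.v h = exp (-vh))
    (j : ℕ) {a : ℕ} (ha : 1 ≤ a) {k₀ : ℤ} (hk₀ : vh + dρ + 2 * k₀ + 2 * j = 2 * a) {ω₀ : Kˣ} (hω₀ : Valued.v (ω₀ : K) = 1)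
    (hη : (ρ h / h * (ρ (α ^ k₀ * Θ (α ^ k₀)) / (α ^ k₀ * Θ (α ^ k₀)))) * (ρ ((ω₀ : K) * Θ ω₀) / ((ω₀ : K) * Θ ω₀)) = -1)
    (H B B' : Subgroup Kˣ) (hH : ∀ u : Kˣ, u ∈ H ↔ Valued.v (u : K) = 1 ∧ Valued.v ((u : K) - ρ u) ≤ Valued.v (ϖE ^ j * (α - ρ α)))
    (hB : ∀ ω : Kˣ, ω ∈ B ↔ Valued.v (ω : K) = 1 ∧ Valued.v ((ω : K) * Θ ω - ρ ((ω : K) * Θ ω)) ≤ exp (2 * (a : ℤ) - 2 * j - dρ))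
    (hB' : ∀ ω : Kˣ, ω ∈ B' ↔ Valued.v (ω : K) = 1 ∧ Valued.v ((ω : K) * Θ ω - ρ ((ω : K) * Θ ω)) ≤ exp (2 * (a : ℤ) - 2 * j - dρ - 1))
    (hHB' : H ≤ B') (hfin : ((QuotientGroup.mk : Kˣ → Kˣ ⧸ H) '' (ω₀ • (B : Set Kˣ))).Finite) :
    (levelSet ρ Θ α ϖE h j a).ncard = H.relIndex B - H.relIndex B' := by
  obtain ⟨hρρ, hvρ, hα, hfix, -, -, -⟩ := id hD
  exact ncard_levelSetR_eq_relIndex_sub hρρ hvρ hvΘ hfix (map_ne_self_of_datum hD) hα (v_sub_map_eq_exp_of_datum hD) hϖE hρϖ hh hvh j ha hk₀ hω₀ hη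
    H B B' hH hB hB' hHB' hfin

/-- **`#levelSet(j,0) = [B : 𝒪_jˣ]`, M∕E RAMIFIED** (`v_h + d_ρ + 2k₀ + 2j = 0`, a unit translator for the class `η·t(α^{k₀})`, `B` at depth `exp(−(2j + d_ρ))`).
[cite: Flicker1998UnitaryFL, p. 84] [cite: Serre1979, Ch. V §3] -/
theorem ncard_levelSet_zero_eq_relIndex_of_ramified (hD : IsRamifiedQuadraticDatum ρ α dρ t) (hvΘ : ∀ x, Valued.v (Θ x) = Valued.v x)
    (hϖE : Valued.v ϖE = exp (-2 : ℤ)) (hρϖ : ρ ϖE = ϖE) (hh : h ≠ 0) {vh : ℤ} (hvh : Valued.v h = exp (-vh))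
    (j : ℕ) {k₀ : ℤ} (hk₀ : vh + dρ + 2 * k₀ + 2 * j = 0) {ω₀ : Kˣ} (hω₀ : Valued.v (ω₀ : K) = 1)
    (hη : (ρ h / h * (ρ (α ^ k₀ * Θ (α ^ k₀)) / (α ^ k₀ * Θ (α ^ k₀)))) * (ρ ((ω₀ : K) * Θ ω₀) / ((ω₀ : K) * Θ ω₀)) = -1)
    (H B : Subgroup Kˣ) (hH : ∀ u : Kˣ, u ∈ H ↔ Valued.v (u : K) = 1 ∧ Valued.v ((u : K) - ρ u) ≤ Valued.v (ϖE ^ j * (α - ρ α)))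
    (hB : ∀ ω : Kˣ, ω ∈ B ↔ Valued.v (ω : K) = 1 ∧ Valued.v ((ω : K) * Θ ω - ρ ((ω : K) * Θ ω)) ≤ exp (-(2 * (j : ℤ) + dρ))) :
    (levelSet ρ Θ α ϖE h j 0).ncard = H.relIndex B := by
  obtain ⟨hρρ, hvρ, hα, hfix, -, -, -⟩ := id hD
  exact ncard_levelSetR_zero_eq_relIndex hρρ hvρ hvΘ hfix (map_ne_self_of_datum hD) hα (v_sub_map_eq_exp_of_datum hD) hϖE hρϖ hh hvh j hk₀ hω₀ hη H B hH hB

/-- **`#levelSet(j,a) = 0` WHEN THE LEVEL EQUATION HAS NO SOLUTION** (e.g. `v_h + d_ρ` odd: then every level is empty), M∕E RAMIFIED. [cite: Flicker1998UnitaryFL, p. 84] -/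
theorem ncard_levelSet_eq_zero_of_ramified (hD : IsRamifiedQuadraticDatum ρ α dρ t) (hvΘ : ∀ x, Valued.v (Θ x) = Valued.v x)
    (hϖE : Valued.v ϖE = exp (-2 : ℤ)) {vh : ℤ} (hvh : Valued.v h = exp (-vh)) (j a : ℕ) (hne : ∀ k : ℤ, vh + dρ + 2 * k + 2 * j ≠ 2 * a)
    (H : Subgroup Kˣ) (hH : ∀ u : Kˣ, u ∈ H ↔ Valued.v (u : K) = 1 ∧ Valued.v ((u : K) - ρ u) ≤ Valued.v (ϖE ^ j * (α - ρ α))) :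
    (levelSet ρ Θ α ϖE h j a).ncard = 0 := by
  obtain ⟨-, hvρ, hα, -, -, -, -⟩ := id hD
  exact ncard_levelSetR_eq_zero_of_forall_ne hvρ hvΘ hα (v_sub_map_eq_exp_of_datum hD) hϖE hvh j a hne H hH

/-! ## §3 The index form: `#levelSet · [U:B]·[U:B′] = q^j·([U:B′] − [U:B])` and `#levelSet(j,0)·[U:B] = q^j` -/

/-- **THE INDEX FORM, `a ≥ 1`** (g32's `n = |G_j|·(1∕I(c) − 1∕I(c+1))` cleared of denominators): with `U = {|u| = 1} ≤ Mˣ`, `H ≤ B′ ≤ B ≤ U`, finite residue field of size `q` and a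
discrete valuation ring of integers, `#levelSet(j,a) · [U : B] · [U : B′] = q^j · ([U : B′] − [U : B])` (`[U : H] = q^j` = ★ p857313; towers `[B : H]·[U : B] = q^j`).
[cite: Flicker1998UnitaryFL, Prop. 7 p. 84] [cite: Serre1979, Ch. V §3] -/
theorem ncard_levelSet_mul_eq_of_ramified [IsDiscreteValuationRing 𝒪[K]] [Finite 𝓀[K]] (hD : IsRamifiedQuadraticDatum ρ α dρ t)
    (hvΘ : ∀ x, Valued.v (Θ x) = Valued.v x) (hϖE : Valued.v ϖE = exp (-2 : ℤ)) (hρϖ : ρ ϖE = ϖE) {q : ℕ} (hq : Nat.card 𝓀[K] = q)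
    (hh : h ≠ 0) {vh : ℤ} (hvh : Valued.v h = exp (-vh))
    (j : ℕ) {a : ℕ} (ha : 1 ≤ a) {k₀ : ℤ} (hk₀ : vh + dρ + 2 * k₀ + 2 * j = 2 * a) {ω₀ : Kˣ} (hω₀ : Valued.v (ω₀ : K) = 1)
    (hη : (ρ h / h * (ρ (α ^ k₀ * Θ (α ^ k₀)) / (α ^ k₀ * Θ (α ^ k₀)))) * (ρ ((ω₀ : K) * Θ ω₀) / ((ω₀ : K) * Θ ω₀)) = -1)
    (U H B B' : Subgroup Kˣ) (hU : ∀ u : Kˣ, u ∈ U ↔ Valued.v (u : K) = 1)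
    (hH : ∀ u : Kˣ, u ∈ H ↔ Valued.v (u : K) = 1 ∧ Valued.v ((u : K) - ρ u) ≤ Valued.v (ϖE ^ j * (α - ρ α)))
    (hB : ∀ ω : Kˣ, ω ∈ B ↔ Valued.v (ω : K) = 1 ∧ Valued.v ((ω : K) * Θ ω - ρ ((ω : K) * Θ ω)) ≤ exp (2 * (a : ℤ) - 2 * j - dρ))
    (hB' : ∀ ω : Kˣ, ω ∈ B' ↔ Valued.v (ω : K) = 1 ∧ Valued.v ((ω : K) * Θ ω - ρ ((ω : K) * Θ ω)) ≤ exp (2 * (a : ℤ) - 2 * j - dρ - 1))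
    (hHB' : H ≤ B') (hB'B : B' ≤ B) (hBU : B ≤ U) (hfin : ((QuotientGroup.mk : Kˣ → Kˣ ⧸ H) '' (ω₀ • (B : Set Kˣ))).Finite) :
    (levelSet ρ Θ α ϖE h j a).ncard * B.relIndex U * B'.relIndex U = q ^ j * (B'.relIndex U - B.relIndex U) := by
  have hcount := ncard_levelSet_eq_relIndex_sub_of_ramified hD hvΘ hϖE hρϖ hh hvh j ha hk₀ hω₀ hη H B B' hH hB hB' hHB' hfin
  have hHU : H.relIndex U = q ^ j := relIndex_orderUnits_eq_of_isRamifiedQuadraticDatum hD hϖE hq j U H hU hH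
  -- towers: `[B : H]·[U : B] = q^j` and `[B′ : H]·[U : B′] = q^j`
  have htB : H.relIndex B * B.relIndex U = q ^ j := by rw [Subgroup.relIndex_mul_relIndex H B U (hHB'.trans hB'B) hBU, hHU]
  have htB' : H.relIndex B' * B'.relIndex U = q ^ j := by rw [Subgroup.relIndex_mul_relIndex H B' U hHB' (hB'B.trans hBU), hHU]
  rw [hcount, Nat.sub_mul, Nat.sub_mul, Nat.mul_sub]
  congr 1
  · rw [htB]
  · rw [mul_right_comm, htB']

/-- **THE INDEX FORM, `a = 0`**: `#levelSet(j,0) · [U : B] = q^j` (`B` at depth `exp(−(2j + d_ρ))`, `H ≤ B ≤ U`). [cite: Flicker1998UnitaryFL, Prop. 7 p. 84] -/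
theorem ncard_levelSet_zero_mul_eq_of_ramified [IsDiscreteValuationRing 𝒪[K]] [Finite 𝓀[K]] (hD : IsRamifiedQuadraticDatum ρ α dρ t)
    (hvΘ : ∀ x, Valued.v (Θ x) = Valued.v x) (hϖE : Valued.v ϖE = exp (-2 : ℤ)) (hρϖ : ρ ϖE = ϖE) {q : ℕ} (hq : Nat.card 𝓀[K] = q)
    (hh : h ≠ 0) {vh : ℤ} (hvh : Valued.v h = exp (-vh)) (j : ℕ) {k₀ : ℤ} (hk₀ : vh + dρ + 2 * k₀ + 2 * j = 0)
    {ω₀ : Kˣ} (hω₀ : Valued.v (ω₀ : K) = 1)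
    (hη : (ρ h / h * (ρ (α ^ k₀ * Θ (α ^ k₀)) / (α ^ k₀ * Θ (α ^ k₀)))) * (ρ ((ω₀ : K) * Θ ω₀) / ((ω₀ : K) * Θ ω₀)) = -1)
    (U H B : Subgroup Kˣ) (hU : ∀ u : Kˣ, u ∈ U ↔ Valued.v (u : K) = 1)
    (hH : ∀ u : Kˣ, u ∈ H ↔ Valued.v (u : K) = 1 ∧ Valued.v ((u : K) - ρ u) ≤ Valued.v (ϖE ^ j * (α - ρ α)))
    (hB : ∀ ω : Kˣ, ω ∈ B ↔ Valued.v (ω : K) = 1 ∧ Valued.v ((ω : K) * Θ ω - ρ ((ω : K) * Θ ω)) ≤ exp (-(2 * (j : ℤ) + dρ)))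
    (hHB : H ≤ B) (hBU : B ≤ U) :
    (levelSet ρ Θ α ϖE h j 0).ncard * B.relIndex U = q ^ j := by
  rw [ncard_levelSet_zero_eq_relIndex_of_ramified hD hvΘ hϖE hρϖ hh hvh j hk₀ hω₀ hη H B hH hB, Subgroup.relIndex_mul_relIndex H B U hHB hBU]
  exact relIndex_orderUnits_eq_of_isRamifiedQuadraticDatum hD hϖE hq j U H hU hH

/-! ## §4 (ED. 2) `hfin` discharged, the quotient forms, and the EXPLICIT kernels (★ p857465 along the third field) -/

section Cosets

variable {G : Type*} [CommGroup G]

/-- A translated class image `mk_H '' (g·B)` is finite as soon as `H.relIndex B ≠ 0` (★ `ncard_image_mk_smul_subgroup`: its `ncard` IS that index). [cite: Serre1979, Ch. V §1] -/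
theorem finite_image_mk_smul_of_relIndex_ne_zero (H B : Subgroup G) (g : G) (h : H.relIndex B ≠ 0) :
    ((QuotientGroup.mk : G → G ⧸ H) '' (g • (B : Set G))).Finite :=
  Set.finite_of_ncard_ne_zero (by rw [ncard_image_mk_smul_subgroup]; exact h)

end Cosets

/-- `q = #𝓀[M] ≠ 0` (a finite residue field is non-empty). [cite: Serre1979, Ch. V §1] -/
theorem card_residueField_ne_zero [Finite 𝓀[K]] {q : ℕ} (hq : Nat.card 𝓀[K] = q) : q ≠ 0 := by
  rw [← hq]; exact Nat.card_pos.ne'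

/-- **THE QUOTIENT FORM, `a ≥ 1`, `hfin` DISCHARGED**: `#levelSet(j,a) = q^j ∕ [U : B] − q^j ∕ [U : B′]` (exact divisions: `[B : H]·[U : B] = q^j = [B′ : H]·[U : B′]`, ★ p857313; the class
image is finite because `[B : H] ≠ 0`). [cite: Flicker1998UnitaryFL, Prop. 7 p. 84] [cite: Serre1979, Ch. V §3] -/
theorem ncard_levelSet_eq_div_sub_div_of_ramified [IsDiscreteValuationRing 𝒪[K]] [Finite 𝓀[K]] (hD : IsRamifiedQuadraticDatum ρ α dρ t)
    (hvΘ : ∀ x, Valued.v (Θ x) = Valued.v x) (hϖE : Valued.v ϖE = exp (-2 : ℤ)) (hρϖ : ρ ϖE = ϖE) {q : ℕ} (hq : Nat.card 𝓀[K] = q)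
    (hh : h ≠ 0) {vh : ℤ} (hvh : Valued.v h = exp (-vh))
    (j : ℕ) {a : ℕ} (ha : 1 ≤ a) {k₀ : ℤ} (hk₀ : vh + dρ + 2 * k₀ + 2 * j = 2 * a) {ω₀ : Kˣ} (hω₀ : Valued.v (ω₀ : K) = 1)
    (hη : (ρ h / h * (ρ (α ^ k₀ * Θ (α ^ k₀)) / (α ^ k₀ * Θ (α ^ k₀)))) * (ρ ((ω₀ : K) * Θ ω₀) / ((ω₀ : K) * Θ ω₀)) = -1)
    (U H B B' : Subgroup Kˣ) (hU : ∀ u : Kˣ, u ∈ U ↔ Valued.v (u : K) = 1)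
    (hH : ∀ u : Kˣ, u ∈ H ↔ Valued.v (u : K) = 1 ∧ Valued.v ((u : K) - ρ u) ≤ Valued.v (ϖE ^ j * (α - ρ α)))
    (hB : ∀ ω : Kˣ, ω ∈ B ↔ Valued.v (ω : K) = 1 ∧ Valued.v ((ω : K) * Θ ω - ρ ((ω : K) * Θ ω)) ≤ exp (2 * (a : ℤ) - 2 * j - dρ))
    (hB' : ∀ ω : Kˣ, ω ∈ B' ↔ Valued.v (ω : K) = 1 ∧ Valued.v ((ω : K) * Θ ω - ρ ((ω : K) * Θ ω)) ≤ exp (2 * (a : ℤ) - 2 * j - dρ - 1))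
    (hHB' : H ≤ B') (hB'B : B' ≤ B) (hBU : B ≤ U) :
    (levelSet ρ Θ α ϖE h j a).ncard = q ^ j / B.relIndex U - q ^ j / B'.relIndex U := by
  have hHU : H.relIndex U = q ^ j := relIndex_orderUnits_eq_of_isRamifiedQuadraticDatum hD hϖE hq j U H hU hH
  have htB : H.relIndex B * B.relIndex U = q ^ j := by rw [Subgroup.relIndex_mul_relIndex H B U (hHB'.trans hB'B) hBU, hHU]
  have htB' : H.relIndex B' * B'.relIndex U = q ^ j := by rw [Subgroup.relIndex_mul_relIndex H B' U hHB' (hB'B.trans hBU), hHU]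
  have hq0 : q ^ j ≠ 0 := pow_ne_zero _ (card_residueField_ne_zero hq)
  have hHB0 : H.relIndex B ≠ 0 := fun h0 => hq0 (by rw [← htB, h0, zero_mul])
  have hBU0 : B.relIndex U ≠ 0 := fun h0 => hq0 (by rw [← htB, h0, mul_zero])
  have hB'U0 : B'.relIndex U ≠ 0 := fun h0 => hq0 (by rw [← htB', h0, mul_zero])
  rw [ncard_levelSet_eq_relIndex_sub_of_ramified hD hvΘ hϖE hρϖ hh hvh j ha hk₀ hω₀ hη H B B' hH hB hB' hHB'
    (finite_image_mk_smul_of_relIndex_ne_zero H B ω₀ hHB0)]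
  have h1 : q ^ j / B.relIndex U = H.relIndex B := by rw [← htB, Nat.mul_div_cancel _ (Nat.pos_of_ne_zero hBU0)]
  have h2 : q ^ j / B'.relIndex U = H.relIndex B' := by rw [← htB', Nat.mul_div_cancel _ (Nat.pos_of_ne_zero hB'U0)]
  rw [h1, h2]

/-- **THE QUOTIENT FORM, `a = 0`**: `#levelSet(j,0) = q^j ∕ [U : B]`. [cite: Flicker1998UnitaryFL, Prop. 7 p. 84] -/
theorem ncard_levelSet_zero_eq_div_of_ramified [IsDiscreteValuationRing 𝒪[K]] [Finite 𝓀[K]] (hD : IsRamifiedQuadraticDatum ρ α dρ t)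
    (hvΘ : ∀ x, Valued.v (Θ x) = Valued.v x) (hϖE : Valued.v ϖE = exp (-2 : ℤ)) (hρϖ : ρ ϖE = ϖE) {q : ℕ} (hq : Nat.card 𝓀[K] = q)
    (hh : h ≠ 0) {vh : ℤ} (hvh : Valued.v h = exp (-vh)) (j : ℕ) {k₀ : ℤ} (hk₀ : vh + dρ + 2 * k₀ + 2 * j = 0)
    {ω₀ : Kˣ} (hω₀ : Valued.v (ω₀ : K) = 1)
    (hη : (ρ h / h * (ρ (α ^ k₀ * Θ (α ^ k₀)) / (α ^ k₀ * Θ (α ^ k₀)))) * (ρ ((ω₀ : K) * Θ ω₀) / ((ω₀ : K) * Θ ω₀)) = -1)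
    (U H B : Subgroup Kˣ) (hU : ∀ u : Kˣ, u ∈ U ↔ Valued.v (u : K) = 1)
    (hH : ∀ u : Kˣ, u ∈ H ↔ Valued.v (u : K) = 1 ∧ Valued.v ((u : K) - ρ u) ≤ Valued.v (ϖE ^ j * (α - ρ α)))
    (hB : ∀ ω : Kˣ, ω ∈ B ↔ Valued.v (ω : K) = 1 ∧ Valued.v ((ω : K) * Θ ω - ρ ((ω : K) * Θ ω)) ≤ exp (-(2 * (j : ℤ) + dρ)))
    (hHB : H ≤ B) (hBU : B ≤ U) :
    (levelSet ρ Θ α ϖE h j 0).ncard = q ^ j / B.relIndex U := by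
  have hmul := ncard_levelSet_zero_mul_eq_of_ramified hD hvΘ hϖE hρϖ hq hh hvh j hk₀ hω₀ hη U H B hU hH hB hHB hBU
  have hBU0 : B.relIndex U ≠ 0 := fun h0 => pow_ne_zero j (card_residueField_ne_zero hq) (by rw [← hmul, h0, mul_zero])
  exact Nat.eq_div_of_mul_eq_left hBU0 hmul

/-! ### Level bridges: the K♮-level `n` is the M-depth `2n` -/

/-- `|jK π′^n| = exp(−2n)` for an embedding of the third field with `|jK π′| = exp(−2)` (`M ∕ K♮` ramified). [cite: Serre1979, Ch. II §2] -/
theorem v_map_pow_eq_exp_neg_two_mul {K' : Type*} [Field K'] (jK : K' →+* K) {π' : K'} (hjπ : Valued.v (jK π') = exp (-2 : ℤ)) (n : ℕ) :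
    Valued.v (jK π' ^ n) = exp (-(2 * (n : ℤ))) := by
  rw [map_pow, hjπ, ← exp_nsmul, nsmul_eq_mul]; congr 1; ring

/-- ODD ROUNDING on `Θ`-fixed values (even valuation by the `Θ`-datum): `|y| ≤ exp(2m − 1) ↔ |y| ≤ exp(2m − 2)`. [cite: Serre1979, Ch. II §2] -/
theorem v_le_exp_odd_iff_of_theta_fixed {ϖ : K} {dΘ tΘ : ℕ} (hDΘ : IsRamifiedQuadraticDatum Θ ϖ dΘ tΘ) {y : K} (hy : Θ y = y) (m : ℤ) :
    Valued.v y ≤ exp (2 * m - 1) ↔ Valued.v y ≤ exp (2 * m - 2) := by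
  rcases eq_or_ne y 0 with rfl | hy0
  · simp
  obtain ⟨n, hn⟩ := hDΘ.2.2.2.1 y hy hy0
  rw [hn, exp_le_exp, exp_le_exp]; omega

omit [Valued K ℤᵐ⁰] in
/-- `N(ω) − ρN(ω)` is `Θ`-fixed (`N(ω) = ωΘω`; `Θ` an involution commuting with `ρ`). [cite: Serre1979, Ch. V §3] -/
theorem theta_norm_sub_map (hΘΘ : ∀ x, Θ (Θ x) = x) (hΘρ : ∀ x, Θ (ρ x) = ρ (Θ x)) (ω : K) :
    Θ (ω * Θ ω - ρ (ω * Θ ω)) = ω * Θ ω - ρ (ω * Θ ω) := by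
  have h1 : Θ (ω * Θ ω) = ω * Θ ω := by rw [map_mul, hΘΘ, mul_comm]
  rw [map_sub, h1, hΘρ, h1]

/-! ### The explicit kernels -/

/-- **THE EXPLICIT CENSUS AT EVEN K♮-LEVEL `k = 2m` (`a ≥ 1`, M∕E RAMIFIED)**: in the frame of §2 plus the third field `K′ = K♮` (ramified datum `(σ′, π′, d′)`, `#𝓀[K′] = q`,
order-compatible `jK : K′ →+* M` onto the `Θ`-fixed elements with `jK∘σ′ = ρ∘jK`, `|jK π′| = exp(−2)`), the `Θ`-datum `(M, Θ, ϖ, dΘ, tΘ)` (complete, finite residue field),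
`Θρ = ρΘ`, the base-unit token `hFN`, and the level bookkeeping `2(d′ + 2m) + 2a = 2j + d_ρ` (so `B` sits at K♮-level `2m`, `B′` at `2m + 1`):
**`#levelSet(j,a) = q^j ∕ I(2m) − q^j ∕ I(2m+1)`**, `I(2m) = if dΘ ≤ 2m+1 then q^m∕2 else q^m`, `I(2m+1) = if dΘ ≤ 2m+2 then q^{m+1}∕2 else q^{m+1}` (★ p857465).
[cite: Flicker1998UnitaryFL, Prop. 7 p. 84] [cite: Serre1979, Ch. V §3 Cor. 3] [cite: Jacobowitz1962, §4] -/
theorem ncard_levelSet_eq_explicit_even_of_ramified [CompleteSpace K] [IsDiscreteValuationRing 𝒪[K]] [Finite 𝓀[K]]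
    {K' : Type*} [Field K'] [Valued K' ℤᵐ⁰] [IsDiscreteValuationRing 𝒪[K']] [Finite 𝓀[K']] {σ' : K' →+* K'} {π' : K'} {d' : ℕ}
    (hD : IsRamifiedQuadraticDatum ρ α dρ t) (hvΘ : ∀ x, Valued.v (Θ x) = Valued.v x) (hϖE : Valued.v ϖE = exp (-2 : ℤ)) (hρϖ : ρ ϖE = ϖE)
    {q : ℕ} (hq : Nat.card 𝓀[K] = q) (hq' : Nat.card 𝓀[K'] = q)
    (hσ' : ∀ x, σ' (σ' x) = x) (hvσ' : ∀ x, Valued.v (σ' x) = Valued.v x) (hfix' : ∀ x : K', σ' x = x → x ≠ 0 → ∃ n : ℤ, Valued.v x = exp (2 * n))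
    (hπ' : Valued.v π' = exp (-1 : ℤ)) (hdd' : Valued.v (π' - σ' π') = Valued.v π' ^ d')
    (jK : K' →+* K) (hjle : ∀ x y : K', Valued.v (jK x) ≤ Valued.v (jK y) ↔ Valued.v x ≤ Valued.v y) (hjΘ : ∀ x, Θ (jK x) = jK x)
    (hjfix : ∀ z : K, Θ z = z → ∃ x, jK x = z) (hjσ : ∀ x, jK (σ' x) = ρ (jK x)) (hjπ : Valued.v (jK π') = exp (-2 : ℤ))
    {ϖ : K} {dΘ tΘ : ℕ} (hDΘ : IsRamifiedQuadraticDatum Θ ϖ dΘ tΘ) (hΘρ : ∀ x, Θ (ρ x) = ρ (Θ x))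
    (hFN : ∀ f : K, ρ f = f → Θ f = f → Valued.v f = 1 → ∃ x : K, x * Θ x = f)
    (hh : h ≠ 0) {vh : ℤ} (hvh : Valued.v h = exp (-vh)) (j : ℕ) {a : ℕ} (ha : 1 ≤ a) {k₀ : ℤ} (hk₀ : vh + dρ + 2 * k₀ + 2 * j = 2 * a)
    {m : ℕ} (hm : 2 * ((d' : ℤ) + 2 * m) + 2 * a = 2 * j + dρ) {ω₀ : Kˣ} (hω₀ : Valued.v (ω₀ : K) = 1)
    (hη : (ρ h / h * (ρ (α ^ k₀ * Θ (α ^ k₀)) / (α ^ k₀ * Θ (α ^ k₀)))) * (ρ ((ω₀ : K) * Θ ω₀) / ((ω₀ : K) * Θ ω₀)) = -1)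
    (U H B B' : Subgroup Kˣ) (hU : ∀ u : Kˣ, u ∈ U ↔ Valued.v (u : K) = 1)
    (hH : ∀ u : Kˣ, u ∈ H ↔ Valued.v (u : K) = 1 ∧ Valued.v ((u : K) - ρ u) ≤ Valued.v (ϖE ^ j * (α - ρ α)))
    (hB : ∀ ω : Kˣ, ω ∈ B ↔ Valued.v (ω : K) = 1 ∧ Valued.v ((ω : K) * Θ ω - ρ ((ω : K) * Θ ω)) ≤ exp (2 * (a : ℤ) - 2 * j - dρ))
    (hB' : ∀ ω : Kˣ, ω ∈ B' ↔ Valued.v (ω : K) = 1 ∧ Valued.v ((ω : K) * Θ ω - ρ ((ω : K) * Θ ω)) ≤ exp (2 * (a : ℤ) - 2 * j - dρ - 1))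
    (hHB' : H ≤ B') (hB'B : B' ≤ B) (hBU : B ≤ U) :
    (levelSet ρ Θ α ϖE h j a).ncard =
      q ^ j / (if dΘ ≤ 2 * m + 1 then q ^ m / 2 else q ^ m) - q ^ j / (if dΘ ≤ 2 * m + 2 then q ^ (m + 1) / 2 else q ^ (m + 1)) := by
  have hΘΘ := hDΘ.1; have hvρ := hD.2.1
  obtain ⟨Ut, hUt⟩ := exists_subgroup_thetaFixed_units (K := K) (Θ := Θ)
  obtain ⟨Vt, hVt⟩ := exists_subgroup_thetaFixed_depth (Θ := Θ) hvρ (Valued.v (jK π' ^ (d' + 2 * m)))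
  obtain ⟨Vt', hVt'⟩ := exists_subgroup_thetaFixed_depth (Θ := Θ) hvρ (Valued.v (jK π' ^ (d' + (2 * m + 1))))
  -- the two norm-depth subgroups read at K♮-levels `2m` and `2m + 1`
  have hlev : exp (2 * (a : ℤ) - 2 * j - dρ) = Valued.v (jK π' ^ (d' + 2 * m)) := by
    rw [v_map_pow_eq_exp_neg_two_mul jK hjπ]; congr 1; push_cast; omega
  have hBj : ∀ ω : Kˣ, ω ∈ B ↔ Valued.v (ω : K) = 1 ∧ Valued.v ((ω : K) * Θ ω - ρ ((ω : K) * Θ ω)) ≤ Valued.v (jK π' ^ (d' + 2 * m)) := by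
    intro ω; rw [hB, hlev]
  have hB'j : ∀ ω : Kˣ, ω ∈ B' ↔ Valued.v (ω : K) = 1 ∧ Valued.v ((ω : K) * Θ ω - ρ ((ω : K) * Θ ω)) ≤ Valued.v (jK π' ^ (d' + (2 * m + 1))) := by
    intro ω
    rw [hB', v_map_pow_eq_exp_neg_two_mul jK hjπ, show (2 * (a : ℤ) - 2 * j - dρ - 1) = 2 * (-((d' : ℤ) + 2 * m)) - 1 by omega,
      v_le_exp_odd_iff_of_theta_fixed hDΘ (theta_norm_sub_map hΘΘ hΘρ _), show (2 * (-((d' : ℤ) + 2 * m)) - 2) = -(2 * ((d' + (2 * m + 1) : ℕ) : ℤ)) by omega]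
  rw [ncard_levelSet_eq_div_sub_div_of_ramified hD hvΘ hϖE hρϖ hq hh hvh j ha hk₀ hω₀ hη U H B B' hU hH hB hB' hHB' hB'B hBU,
    relIndex_normDepth_eq_ite_pow_of_ramified hσ' hvσ' hfix' hπ' hdd' hq' jK hjle hjΘ hjfix hjσ hjπ hDΘ hFN m U Ut Vt B hU hUt hVt hBj,
    relIndex_normDepth_odd_eq_ite_pow_of_ramified hσ' hvσ' hfix' hπ' hdd' hq' jK hjle hjΘ hjfix hjσ hjπ hDΘ hFN m U Ut Vt' B' hU hUt hVt' hB'j]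

/-- **THE EXPLICIT CENSUS AT ODD K♮-LEVEL `k = 2m + 1` (`a ≥ 1`)**: level bookkeeping `2(d′ + 2m + 1) + 2a = 2j + d_ρ` (`B` at K♮-level `2m+1`, `B′` at `2m+2`):
**`#levelSet(j,a) = q^j ∕ I(2m+1) − q^j ∕ I(2m+2)`**, `I(2m+1) = if dΘ ≤ 2m+2 then q^{m+1}∕2 else q^{m+1}`, `I(2m+2) = if dΘ ≤ 2m+3 then q^{m+1}∕2 else q^{m+1}` — equal
Mars factors, so the count is `0` whenever `dΘ ≠ 2m + 3` (always, `dΘ` being even in type RamM). [cite: Flicker1998UnitaryFL, Prop. 7 p. 84] [cite: Serre1979, Ch. V §3 Cor. 3] -/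
theorem ncard_levelSet_eq_explicit_odd_of_ramified [CompleteSpace K] [IsDiscreteValuationRing 𝒪[K]] [Finite 𝓀[K]]
    {K' : Type*} [Field K'] [Valued K' ℤᵐ⁰] [IsDiscreteValuationRing 𝒪[K']] [Finite 𝓀[K']] {σ' : K' →+* K'} {π' : K'} {d' : ℕ}
    (hD : IsRamifiedQuadraticDatum ρ α dρ t) (hvΘ : ∀ x, Valued.v (Θ x) = Valued.v x) (hϖE : Valued.v ϖE = exp (-2 : ℤ)) (hρϖ : ρ ϖE = ϖE)
    {q : ℕ} (hq : Nat.card 𝓀[K] = q) (hq' : Nat.card 𝓀[K'] = q)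
    (hσ' : ∀ x, σ' (σ' x) = x) (hvσ' : ∀ x, Valued.v (σ' x) = Valued.v x) (hfix' : ∀ x : K', σ' x = x → x ≠ 0 → ∃ n : ℤ, Valued.v x = exp (2 * n))
    (hπ' : Valued.v π' = exp (-1 : ℤ)) (hdd' : Valued.v (π' - σ' π') = Valued.v π' ^ d')
    (jK : K' →+* K) (hjle : ∀ x y : K', Valued.v (jK x) ≤ Valued.v (jK y) ↔ Valued.v x ≤ Valued.v y) (hjΘ : ∀ x, Θ (jK x) = jK x)
    (hjfix : ∀ z : K, Θ z = z → ∃ x, jK x = z) (hjσ : ∀ x, jK (σ' x) = ρ (jK x)) (hjπ : Valued.v (jK π') = exp (-2 : ℤ))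
    {ϖ : K} {dΘ tΘ : ℕ} (hDΘ : IsRamifiedQuadraticDatum Θ ϖ dΘ tΘ) (hΘρ : ∀ x, Θ (ρ x) = ρ (Θ x))
    (hFN : ∀ f : K, ρ f = f → Θ f = f → Valued.v f = 1 → ∃ x : K, x * Θ x = f)
    (hh : h ≠ 0) {vh : ℤ} (hvh : Valued.v h = exp (-vh)) (j : ℕ) {a : ℕ} (ha : 1 ≤ a) {k₀ : ℤ} (hk₀ : vh + dρ + 2 * k₀ + 2 * j = 2 * a)
    {m : ℕ} (hm : 2 * ((d' : ℤ) + 2 * m + 1) + 2 * a = 2 * j + dρ) {ω₀ : Kˣ} (hω₀ : Valued.v (ω₀ : K) = 1)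
    (hη : (ρ h / h * (ρ (α ^ k₀ * Θ (α ^ k₀)) / (α ^ k₀ * Θ (α ^ k₀)))) * (ρ ((ω₀ : K) * Θ ω₀) / ((ω₀ : K) * Θ ω₀)) = -1)
    (U H B B' : Subgroup Kˣ) (hU : ∀ u : Kˣ, u ∈ U ↔ Valued.v (u : K) = 1)
    (hH : ∀ u : Kˣ, u ∈ H ↔ Valued.v (u : K) = 1 ∧ Valued.v ((u : K) - ρ u) ≤ Valued.v (ϖE ^ j * (α - ρ α)))
    (hB : ∀ ω : Kˣ, ω ∈ B ↔ Valued.v (ω : K) = 1 ∧ Valued.v ((ω : K) * Θ ω - ρ ((ω : K) * Θ ω)) ≤ exp (2 * (a : ℤ) - 2 * j - dρ))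
    (hB' : ∀ ω : Kˣ, ω ∈ B' ↔ Valued.v (ω : K) = 1 ∧ Valued.v ((ω : K) * Θ ω - ρ ((ω : K) * Θ ω)) ≤ exp (2 * (a : ℤ) - 2 * j - dρ - 1))
    (hHB' : H ≤ B') (hB'B : B' ≤ B) (hBU : B ≤ U) :
    (levelSet ρ Θ α ϖE h j a).ncard =
      q ^ j / (if dΘ ≤ 2 * m + 2 then q ^ (m + 1) / 2 else q ^ (m + 1)) - q ^ j / (if dΘ ≤ 2 * (m + 1) + 1 then q ^ (m + 1) / 2 else q ^ (m + 1)) := by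
  have hΘΘ := hDΘ.1; have hvρ := hD.2.1
  obtain ⟨Ut, hUt⟩ := exists_subgroup_thetaFixed_units (K := K) (Θ := Θ)
  obtain ⟨Vt, hVt⟩ := exists_subgroup_thetaFixed_depth (Θ := Θ) hvρ (Valued.v (jK π' ^ (d' + (2 * m + 1))))
  obtain ⟨Vt', hVt'⟩ := exists_subgroup_thetaFixed_depth (Θ := Θ) hvρ (Valued.v (jK π' ^ (d' + 2 * (m + 1))))
  have hlev : exp (2 * (a : ℤ) - 2 * j - dρ) = Valued.v (jK π' ^ (d' + (2 * m + 1))) := by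
    rw [v_map_pow_eq_exp_neg_two_mul jK hjπ]; congr 1; push_cast; omega
  have hBj : ∀ ω : Kˣ, ω ∈ B ↔ Valued.v (ω : K) = 1 ∧ Valued.v ((ω : K) * Θ ω - ρ ((ω : K) * Θ ω)) ≤ Valued.v (jK π' ^ (d' + (2 * m + 1))) := by
    intro ω; rw [hB, hlev]
  have hB'j : ∀ ω : Kˣ, ω ∈ B' ↔ Valued.v (ω : K) = 1 ∧ Valued.v ((ω : K) * Θ ω - ρ ((ω : K) * Θ ω)) ≤ Valued.v (jK π' ^ (d' + 2 * (m + 1))) := by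
    intro ω
    rw [hB', v_map_pow_eq_exp_neg_two_mul jK hjπ, show (2 * (a : ℤ) - 2 * j - dρ - 1) = 2 * (-((d' : ℤ) + 2 * m + 1)) - 1 by omega,
      v_le_exp_odd_iff_of_theta_fixed hDΘ (theta_norm_sub_map hΘΘ hΘρ _), show (2 * (-((d' : ℤ) + 2 * m + 1)) - 2) = -(2 * ((d' + 2 * (m + 1) : ℕ) : ℤ)) by omega]
  rw [ncard_levelSet_eq_div_sub_div_of_ramified hD hvΘ hϖE hρϖ hq hh hvh j ha hk₀ hω₀ hη U H B B' hU hH hB hB' hHB' hB'B hBU,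
    relIndex_normDepth_odd_eq_ite_pow_of_ramified hσ' hvσ' hfix' hπ' hdd' hq' jK hjle hjΘ hjfix hjσ hjπ hDΘ hFN m U Ut Vt B hU hUt hVt hBj,
    relIndex_normDepth_eq_ite_pow_of_ramified hσ' hvσ' hfix' hπ' hdd' hq' jK hjle hjΘ hjfix hjσ hjπ hDΘ hFN (m + 1) U Ut Vt' B' hU hUt hVt' hB'j]

/-! ## §5 (ED. 3) The level-0 kernels explicit (seam S8 ∕ brick (C2)) -/

/-- **THE EXPLICIT LEVEL-0 COUNT AT EVEN K♮-LEVEL** (`a = 0`, `B` at K♮-level `2m`: `2(d′ + 2m) = 2j + d_ρ`): `#levelSet(j,0) = q^j ∕ I(2m)`, `I(2m) = if dΘ ≤ 2m+1 then q^m∕2 else q^m`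
(★ p857465; frame and translator as in §4). [cite: Flicker1998UnitaryFL, Prop. 7 p. 84] [cite: Serre1979, Ch. V §3 Cor. 3] -/
theorem ncard_levelSet_zero_eq_explicit_even_of_ramified [CompleteSpace K] [IsDiscreteValuationRing 𝒪[K]] [Finite 𝓀[K]]
    {K' : Type*} [Field K'] [Valued K' ℤᵐ⁰] [IsDiscreteValuationRing 𝒪[K']] [Finite 𝓀[K']] {σ' : K' →+* K'} {π' : K'} {d' : ℕ}
    (hD : IsRamifiedQuadraticDatum ρ α dρ t) (hvΘ : ∀ x, Valued.v (Θ x) = Valued.v x) (hϖE : Valued.v ϖE = exp (-2 : ℤ)) (hρϖ : ρ ϖE = ϖE)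
    {q : ℕ} (hq : Nat.card 𝓀[K] = q) (hq' : Nat.card 𝓀[K'] = q)
    (hσ' : ∀ x, σ' (σ' x) = x) (hvσ' : ∀ x, Valued.v (σ' x) = Valued.v x) (hfix' : ∀ x : K', σ' x = x → x ≠ 0 → ∃ n : ℤ, Valued.v x = exp (2 * n))
    (hπ' : Valued.v π' = exp (-1 : ℤ)) (hdd' : Valued.v (π' - σ' π') = Valued.v π' ^ d')
    (jK : K' →+* K) (hjle : ∀ x y : K', Valued.v (jK x) ≤ Valued.v (jK y) ↔ Valued.v x ≤ Valued.v y) (hjΘ : ∀ x, Θ (jK x) = jK x)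
    (hjfix : ∀ z : K, Θ z = z → ∃ x, jK x = z) (hjσ : ∀ x, jK (σ' x) = ρ (jK x)) (hjπ : Valued.v (jK π') = exp (-2 : ℤ))
    {ϖ : K} {dΘ tΘ : ℕ} (hDΘ : IsRamifiedQuadraticDatum Θ ϖ dΘ tΘ)
    (hFN : ∀ f : K, ρ f = f → Θ f = f → Valued.v f = 1 → ∃ x : K, x * Θ x = f)
    (hh : h ≠ 0) {vh : ℤ} (hvh : Valued.v h = exp (-vh)) (j : ℕ) {k₀ : ℤ} (hk₀ : vh + dρ + 2 * k₀ + 2 * j = 0)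
    {m : ℕ} (hm : 2 * ((d' : ℤ) + 2 * m) = 2 * j + dρ) {ω₀ : Kˣ} (hω₀ : Valued.v (ω₀ : K) = 1)
    (hη : (ρ h / h * (ρ (α ^ k₀ * Θ (α ^ k₀)) / (α ^ k₀ * Θ (α ^ k₀)))) * (ρ ((ω₀ : K) * Θ ω₀) / ((ω₀ : K) * Θ ω₀)) = -1)
    (U H B : Subgroup Kˣ) (hU : ∀ u : Kˣ, u ∈ U ↔ Valued.v (u : K) = 1)
    (hH : ∀ u : Kˣ, u ∈ H ↔ Valued.v (u : K) = 1 ∧ Valued.v ((u : K) - ρ u) ≤ Valued.v (ϖE ^ j * (α - ρ α)))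
    (hB : ∀ ω : Kˣ, ω ∈ B ↔ Valued.v (ω : K) = 1 ∧ Valued.v ((ω : K) * Θ ω - ρ ((ω : K) * Θ ω)) ≤ exp (-(2 * (j : ℤ) + dρ)))
    (hHB : H ≤ B) (hBU : B ≤ U) :
    (levelSet ρ Θ α ϖE h j 0).ncard = q ^ j / (if dΘ ≤ 2 * m + 1 then q ^ m / 2 else q ^ m) := by
  obtain ⟨Ut, hUt⟩ := exists_subgroup_thetaFixed_units (K := K) (Θ := Θ)
  obtain ⟨Vt, hVt⟩ := exists_subgroup_thetaFixed_depth (Θ := Θ) hD.2.1 (Valued.v (jK π' ^ (d' + 2 * m)))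
  have hBj : ∀ ω : Kˣ, ω ∈ B ↔ Valued.v (ω : K) = 1 ∧ Valued.v ((ω : K) * Θ ω - ρ ((ω : K) * Θ ω)) ≤ Valued.v (jK π' ^ (d' + 2 * m)) := by
    intro ω; rw [hB, v_map_pow_eq_exp_neg_two_mul jK hjπ, show -(2 * (j : ℤ) + dρ) = -(2 * ((d' + 2 * m : ℕ) : ℤ)) by push_cast; omega]
  rw [ncard_levelSet_zero_eq_div_of_ramified hD hvΘ hϖE hρϖ hq hh hvh j hk₀ hω₀ hη U H B hU hH hB hHB hBU,
    relIndex_normDepth_eq_ite_pow_of_ramified hσ' hvσ' hfix' hπ' hdd' hq' jK hjle hjΘ hjfix hjσ hjπ hDΘ hFN m U Ut Vt B hU hUt hVt hBj]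

/-- **THE EXPLICIT LEVEL-0 COUNT AT ODD K♮-LEVEL** (`a = 0`, `B` at K♮-level `2m + 1`: `2(d′ + 2m + 1) = 2j + d_ρ`): `#levelSet(j,0) = q^j ∕ I(2m+1)`,
`I(2m+1) = if dΘ ≤ 2m+2 then q^{m+1}∕2 else q^{m+1}` (★ p857465). [cite: Flicker1998UnitaryFL, Prop. 7 p. 84] [cite: Serre1979, Ch. V §3 Cor. 3] -/
theorem ncard_levelSet_zero_eq_explicit_odd_of_ramified [CompleteSpace K] [IsDiscreteValuationRing 𝒪[K]] [Finite 𝓀[K]]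
    {K' : Type*} [Field K'] [Valued K' ℤᵐ⁰] [IsDiscreteValuationRing 𝒪[K']] [Finite 𝓀[K']] {σ' : K' →+* K'} {π' : K'} {d' : ℕ}
    (hD : IsRamifiedQuadraticDatum ρ α dρ t) (hvΘ : ∀ x, Valued.v (Θ x) = Valued.v x) (hϖE : Valued.v ϖE = exp (-2 : ℤ)) (hρϖ : ρ ϖE = ϖE)
    {q : ℕ} (hq : Nat.card 𝓀[K] = q) (hq' : Nat.card 𝓀[K'] = q)
    (hσ' : ∀ x, σ' (σ' x) = x) (hvσ' : ∀ x, Valued.v (σ' x) = Valued.v x) (hfix' : ∀ x : K', σ' x = x → x ≠ 0 → ∃ n : ℤ, Valued.v x = exp (2 * n))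
    (hπ' : Valued.v π' = exp (-1 : ℤ)) (hdd' : Valued.v (π' - σ' π') = Valued.v π' ^ d')
    (jK : K' →+* K) (hjle : ∀ x y : K', Valued.v (jK x) ≤ Valued.v (jK y) ↔ Valued.v x ≤ Valued.v y) (hjΘ : ∀ x, Θ (jK x) = jK x)
    (hjfix : ∀ z : K, Θ z = z → ∃ x, jK x = z) (hjσ : ∀ x, jK (σ' x) = ρ (jK x)) (hjπ : Valued.v (jK π') = exp (-2 : ℤ))
    {ϖ : K} {dΘ tΘ : ℕ} (hDΘ : IsRamifiedQuadraticDatum Θ ϖ dΘ tΘ)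
    (hFN : ∀ f : K, ρ f = f → Θ f = f → Valued.v f = 1 → ∃ x : K, x * Θ x = f)
    (hh : h ≠ 0) {vh : ℤ} (hvh : Valued.v h = exp (-vh)) (j : ℕ) {k₀ : ℤ} (hk₀ : vh + dρ + 2 * k₀ + 2 * j = 0)
    {m : ℕ} (hm : 2 * ((d' : ℤ) + 2 * m + 1) = 2 * j + dρ) {ω₀ : Kˣ} (hω₀ : Valued.v (ω₀ : K) = 1)
    (hη : (ρ h / h * (ρ (α ^ k₀ * Θ (α ^ k₀)) / (α ^ k₀ * Θ (α ^ k₀)))) * (ρ ((ω₀ : K) * Θ ω₀) / ((ω₀ : K) * Θ ω₀)) = -1)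
    (U H B : Subgroup Kˣ) (hU : ∀ u : Kˣ, u ∈ U ↔ Valued.v (u : K) = 1)
    (hH : ∀ u : Kˣ, u ∈ H ↔ Valued.v (u : K) = 1 ∧ Valued.v ((u : K) - ρ u) ≤ Valued.v (ϖE ^ j * (α - ρ α)))
    (hB : ∀ ω : Kˣ, ω ∈ B ↔ Valued.v (ω : K) = 1 ∧ Valued.v ((ω : K) * Θ ω - ρ ((ω : K) * Θ ω)) ≤ exp (-(2 * (j : ℤ) + dρ)))
    (hHB : H ≤ B) (hBU : B ≤ U) :
    (levelSet ρ Θ α ϖE h j 0).ncard = q ^ j / (if dΘ ≤ 2 * m + 2 then q ^ (m + 1) / 2 else q ^ (m + 1)) := by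
  obtain ⟨Ut, hUt⟩ := exists_subgroup_thetaFixed_units (K := K) (Θ := Θ)
  obtain ⟨Vt, hVt⟩ := exists_subgroup_thetaFixed_depth (Θ := Θ) hD.2.1 (Valued.v (jK π' ^ (d' + (2 * m + 1))))
  have hBj : ∀ ω : Kˣ, ω ∈ B ↔ Valued.v (ω : K) = 1 ∧ Valued.v ((ω : K) * Θ ω - ρ ((ω : K) * Θ ω)) ≤ Valued.v (jK π' ^ (d' + (2 * m + 1))) := by
    intro ω; rw [hB, v_map_pow_eq_exp_neg_two_mul jK hjπ, show -(2 * (j : ℤ) + dρ) = -(2 * ((d' + (2 * m + 1) : ℕ) : ℤ)) by push_cast; omega]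
  rw [ncard_levelSet_zero_eq_div_of_ramified hD hvΘ hϖE hρϖ hq hh hvh j hk₀ hω₀ hη U H B hU hH hB hHB hBU,
    relIndex_normDepth_odd_eq_ite_pow_of_ramified hσ' hvσ' hfix' hπ' hdd' hq' jK hjle hjΘ hjfix hjσ hjπ hDΘ hFN m U Ut Vt B hU hUt hVt hBj]

end Summit.HodgeConjecture.HodgeConjecture.Cruxes.H413.F0P3cDyRamToricLevelCensusRamM
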